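import Summits.QuantumFields.YangMills.Theorems.BalabanUVNodesN15TwoSpacingGluingCurvedCoverDefectCubes
import Summits.QuantumFields.YangMills.Theorems.BalabanUVNodesN15NeumannCubeRightEntriesDefectClosed
import Summits.QuantumFields.YangMills.Theorems.BalabanUVNodesN15CurvedGluingCubeSmoothCut
import HarnessLib

/-!
# THE TWO-GRID η-DEFECTS OF THE IMAGES CUBE's SANDWICHED RIGHT ENTRIES READ ON THE COVER's CUBES — dag-n15-a N-IIn (c)⁻ `hasMaj_idef_rightBgrad` and N-IIr (c)⁺ `hasMaj_idef_rightGrad`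
# (torus family, cube side `L^{m+1}`, exponent `−1∕(8(d+1))`, rates `δ_±`) RESHAPED to the cover's cube (side `L·L^m`, a common rate `δ ≤ δ_±`), and the generic box-cut η-defect of a
# two-sidedly localized pair (`𝔇(M_{a′}T′, M_aT) ≤ 1_S1_S(1·m + o·k)`)
# (dag-n15-c g19, n15-c∕177a; N15 = NE2, s1 road (c) — the producers of n15-c∕174's `hDTf`∕`hDTb`∕`hITf`∕`hITb` at the cover; FILE 122b's pattern)

Cell `pub-ymgap`, seat `pub-ymgap-dag-n15-c` (R134 (a); HUMAN RULING D-0062), generation 19.  `bears_on: R4∕N15 · K3⁸ SpineGivenEndpointR13SepCoPHV (stmt-QuantumFields-27366)`.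
Filed `--kind proof --supports stmt-QuantumFields-27366 --as helper` — COUNT-NEUTRAL.  Theorems only; 0 `def`, 0 `sorry`.  Imports BY NAME FILE 122b `…CurvedCoverDefectCubes` (`hasMaj_rate_le`
through FILE 77; the cover family objects), dag-n15-a N-IIr `…NeumannCubeRightEntriesDefectClosed` (★★★ `hasMaj_idef_rightGrad`; through it N-IIn `hasMaj_idef_rightBgrad`), dag-n15-w3 file 35
`…CurvedGluingCubeSmoothCut` (`hasMaj_mulOp_comp_loc₂'`, `hasMaj_idef_mulOp_comp_loc₂`).  Nothing in the tree is modified; nothing restated.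

WHAT.  §1 `hasMaj_idef_rightEntryF_cover_of` ∕ `hasMaj_idef_rightEntryB_cover_of` (reshaping, `L^{m+1} = L·L^m`, rate weakened); §2 `hasMaj_idef_cut_comp_loc₂` (generic: from `T ≤ 1_S1_S·k`,
`𝔇(T′,T) ≤ 1_S1_S·m`, `|a′| ≤ 1`, `|a′ − a∘π| ≤ o` conclude `𝔇(M_{a′}T′, M_aT) ≤ 1_S1_S·(1·m + o·k)`, FILE 148 §3's `idef_comp` bookkeeping).

HONEST FRAMING ∕ LIMITS.  Bookkeeping over LANDED rows on dag-n15-a's MODEL carriers; nothing of [B5]∕[B6]∕[B9] asserted (Thm 3.14 pp.426–427 = difference TEMPLATE; (2.133) p.247 shape).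
NE2 for non-abelian `G(U)` NOT proved; N15 of record untouched (№253); no count; one finite 𝕋⁴ at fixed ε — NOT infinite volume, NOT OS, NOT a mass gap, NOT Clay.  Restate-immune.
-/

noncomputable section

namespace Summit.QuantumFields.YangMills.BalabanUVNodes.N15.Gluing

open Literature.MathematicalPhysics.QuantumFieldTheory.Balaban1983to89
open Literature.MathematicalPhysics.QuantumFieldTheory.Balaban1983to89.B5Prop11Plancherel (Tor fine)
open Literature.MathematicalPhysics.QuantumFieldTheory.Balaban1983to89.B11SectG (BlockNorm HasMaj)
open Literature.MathematicalPhysics.QuantumFieldTheory.Balaban1983to89.T4EtaRateDefect (idef idef_comp)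
open Literature.MathematicalPhysics.QuantumFieldTheory.Balaban1983to89.T4EtaRateCoeffDefect (pull)
open Literature.MathematicalPhysics.QuantumFieldTheory.Balaban1983to89.B6Prop26Gluing (mulOp ind ind_nonneg)
open Literature.MathematicalPhysics.QuantumFieldTheory.Balaban1983to89.B6UnitTorusCarrier (unitTorusGeo)
open Literature.MathematicalPhysics.QuantumFieldTheory.Balaban1983to89.B5SiteBridgeP12 (MP)
open Literature.MathematicalPhysics.QuantumFieldTheory.King1986.Torus (blockOf tdistT tdistT_nonneg)
open Summit.QuantumFields.YangMills.BalabanUVNodes.N15.VectorPiece (bshiftEquiv kingPrV blkFine)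
open Summit.QuantumFields.YangMills.BalabanUVNodes.N15.MatrixSpecies (liftBlk liftMap)
open Summit.QuantumFields.YangMills.BalabanUVNodes.N15.TwoGrid (symbOp sD sTinv symOp gOp paramsOf neumannCubeG chiCube cubeBlocks hasMaj_idef_rightGrad hasMaj_idef_rightBgrad)
open Summit.QuantumFields.YangMills.BalabanUVNodes.N15.CurvedSpecies (hasMaj_mulOp_comp_loc₂' hasMaj_idef_mulOp_comp_loc₂)

variable {d : ℕ}

/-! ## §1 dag-n15-a's right-entry defect rows reshaped to the cover's cubes -/

section Cover

variable {L : ℕ} [NeZero L] (mv kk r : ℕ) (hL : Odd L ∧ 1 < L) (a : ℝ)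

/-- ★ **(c)⁺ ON THE COVER's CUBE**: N-IIr's row for the cube of corner `c(k)` and side `L^{m+1} = L·L^m` at a weakened rate `δ ≤ δ₊`. [cite: Balaban1985BackgroundPropagators, Thm 3.14 pp.426–427 (difference template); Balaban1984PropagatorsII, (2.133) p.247 (shape)] -/
theorem hasMaj_idef_rightEntryF_cover_of {δf m δ : ℝ} (hm : 0 ≤ m) (hδ : δ ≤ δf) (k : Fin (d + 1) → ZMod (2 * L)) (μ : Fin (d + 1))
    (h : HasMaj (BlockNorm.ofBlocks (unitTorusGeo L kk (cvM d L mv kk hL)) (blkFine L kk (cvM d L mv kk hL)))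
      (BlockNorm.ofBlocks (unitTorusGeo L kk (cvM d L mv kk hL)) (fun i : (Tor (fine (L ^ r * L ^ kk) (cvM d L mv kk hL)) × Fin (d + 1)) => blockOf (L ^ r * L ^ kk) (cvM d L mv kk hL) i.1))
      (idef (pull (kingPrV L kk r (cvM d L mv kk hL))) (pull (kingPrV L kk r (cvM d L mv kk hL)))
        (mulOp (chiCube (cvM d L mv kk hL) (L ^ r * L ^ kk) (coverCorner (cvM d L mv kk hL) (L ^ mv) L (coverMargin L mv) k) (L ^ (mv + 1))) ∘ₗ
            symOp (cvM d L mv kk hL) (L ^ r * L ^ kk) (coverCorner (cvM d L mv kk hL) (L ^ mv) L (coverMargin L mv) k) ∘ₗ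
          (gOp (cvM d L mv kk hL) (L ^ r * L ^ kk) a ∘ₗ symbOp (cvM d L mv kk hL) (L ^ r * L ^ kk) (sD (cvM d L mv kk hL) (L ^ r * L ^ kk) μ ((L ^ r * L ^ kk : ℕ) : ℝ))) ∘ₗ
          mulOp (chiCube (cvM d L mv kk hL) (L ^ r * L ^ kk) (coverCorner (cvM d L mv kk hL) (L ^ mv) L (coverMargin L mv) k) (L ^ (mv + 1))))
        (mulOp (chiCube (cvM d L mv kk hL) (L ^ kk) (coverCorner (cvM d L mv kk hL) (L ^ mv) L (coverMargin L mv) k) (L ^ (mv + 1))) ∘ₗ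
            symOp (cvM d L mv kk hL) (L ^ kk) (coverCorner (cvM d L mv kk hL) (L ^ mv) L (coverMargin L mv) k) ∘ₗ
          (gOp (cvM d L mv kk hL) (L ^ kk) a ∘ₗ symbOp (cvM d L mv kk hL) (L ^ kk) (sD (cvM d L mv kk hL) (L ^ kk) μ ((L ^ kk : ℕ) : ℝ))) ∘ₗ
          mulOp (chiCube (cvM d L mv kk hL) (L ^ kk) (coverCorner (cvM d L mv kk hL) (L ^ mv) L (coverMargin L mv) k) (L ^ (mv + 1)))))
      (fun y y' => ind ((cubeBlocks (cvM d L mv kk hL) (coverCorner (cvM d L mv kk hL) (L ^ mv) L (coverMargin L mv) k) (L ^ (mv + 1)) : Finset _) : Set _) y *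
        ind ((cubeBlocks (cvM d L mv kk hL) (coverCorner (cvM d L mv kk hL) (L ^ mv) L (coverMargin L mv) k) (L ^ (mv + 1)) : Finset _) : Set _) y' *
        (m * ((L ^ kk : ℕ) : ℝ) ^ (-(1 / (8 * ((d : ℝ) + 1)))) * Real.exp (-(δf * tdistT (cvM d L mv kk hL) y y'))))) :
    HasMaj (BlockNorm.ofBlocks (unitTorusGeo L kk (cvM d L mv kk hL)) (fun b : CvX d L mv kk hL => blockOf (L ^ kk) (cvM d L mv kk hL) b.1))
      (BlockNorm.ofBlocks (unitTorusGeo L kk (cvM d L mv kk hL)) (fun i : (Tor (fine (L ^ r * L ^ kk) (cvM d L mv kk hL)) × Fin (d + 1)) => blockOf (L ^ r * L ^ kk) (cvM d L mv kk hL) i.1))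
      (idef (pull (kingPrV L kk r (cvM d L mv kk hL))) (pull (kingPrV L kk r (cvM d L mv kk hL)))
        (mulOp (chiCube (cvM d L mv kk hL) (L ^ r * L ^ kk) (coverCorner (cvM d L mv kk hL) (L ^ mv) L (coverMargin L mv) k) (L * L ^ mv)) ∘ₗ
            symOp (cvM d L mv kk hL) (L ^ r * L ^ kk) (coverCorner (cvM d L mv kk hL) (L ^ mv) L (coverMargin L mv) k) ∘ₗ
          (gOp (cvM d L mv kk hL) (L ^ r * L ^ kk) a ∘ₗ symbOp (cvM d L mv kk hL) (L ^ r * L ^ kk) (sD (cvM d L mv kk hL) (L ^ r * L ^ kk) μ ((L ^ r * L ^ kk : ℕ) : ℝ))) ∘ₗ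
          mulOp (chiCube (cvM d L mv kk hL) (L ^ r * L ^ kk) (coverCorner (cvM d L mv kk hL) (L ^ mv) L (coverMargin L mv) k) (L * L ^ mv)))
        (mulOp (chiCube (cvM d L mv kk hL) (L ^ kk) (coverCorner (cvM d L mv kk hL) (L ^ mv) L (coverMargin L mv) k) (L * L ^ mv)) ∘ₗ
            symOp (cvM d L mv kk hL) (L ^ kk) (coverCorner (cvM d L mv kk hL) (L ^ mv) L (coverMargin L mv) k) ∘ₗ
          (gOp (cvM d L mv kk hL) (L ^ kk) a ∘ₗ symbOp (cvM d L mv kk hL) (L ^ kk) (sD (cvM d L mv kk hL) (L ^ kk) μ ((L ^ kk : ℕ) : ℝ))) ∘ₗ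
          mulOp (chiCube (cvM d L mv kk hL) (L ^ kk) (coverCorner (cvM d L mv kk hL) (L ^ mv) L (coverMargin L mv) k) (L * L ^ mv))))
      (fun y y' => ind (g := unitTorusGeo L kk (cvM d L mv kk hL)) (cvSk d L mv kk hL k) y * ind (g := unitTorusGeo L kk (cvM d L mv kk hL)) (cvSk d L mv kk hL k) y' *
        (m * ((L ^ kk : ℕ) : ℝ) ^ (-(1 / (8 * ((d : ℝ) + 1)))) * Real.exp (-(δ * tdistT (cvM d L mv kk hL) y y')))) := by
  rw [show L ^ (mv + 1) = L * L ^ mv by rw [pow_succ, mul_comm]] at h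
  exact hasMaj_rate_le (fun y y' => mul_nonneg (ind_nonneg _ _) (ind_nonneg _ _)) (mul_nonneg hm (Real.rpow_nonneg (Nat.cast_nonneg _) _)) hδ h

/-- ★ **(c)⁻ ON THE COVER's CUBE**: N-IIn's row, likewise. [cite: Balaban1985BackgroundPropagators, Thm 3.14 pp.426–427 (difference template); Balaban1984PropagatorsII, (2.133) p.247 (shape)] -/
theorem hasMaj_idef_rightEntryB_cover_of {δb m δ : ℝ} (hm : 0 ≤ m) (hδ : δ ≤ δb) (k : Fin (d + 1) → ZMod (2 * L)) (μ : Fin (d + 1))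
    (h : HasMaj (BlockNorm.ofBlocks (unitTorusGeo L kk (cvM d L mv kk hL)) (blkFine L kk (cvM d L mv kk hL)))
      (BlockNorm.ofBlocks (unitTorusGeo L kk (cvM d L mv kk hL)) (fun i : (Tor (fine (L ^ r * L ^ kk) (cvM d L mv kk hL)) × Fin (d + 1)) => blockOf (L ^ r * L ^ kk) (cvM d L mv kk hL) i.1))
      (idef (pull (kingPrV L kk r (cvM d L mv kk hL))) (pull (kingPrV L kk r (cvM d L mv kk hL)))
        (-(mulOp (chiCube (cvM d L mv kk hL) (L ^ r * L ^ kk) (coverCorner (cvM d L mv kk hL) (L ^ mv) L (coverMargin L mv) k) (L ^ (mv + 1))) ∘ₗ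
            symOp (cvM d L mv kk hL) (L ^ r * L ^ kk) (coverCorner (cvM d L mv kk hL) (L ^ mv) L (coverMargin L mv) k) ∘ₗ
          (gOp (cvM d L mv kk hL) (L ^ r * L ^ kk) a ∘ₗ symbOp (cvM d L mv kk hL) (L ^ r * L ^ kk) (((L ^ r * L ^ kk : ℕ) : ℝ) • (sTinv (cvM d L mv kk hL) (L ^ r * L ^ kk) μ - 1))) ∘ₗ
          mulOp (chiCube (cvM d L mv kk hL) (L ^ r * L ^ kk) (coverCorner (cvM d L mv kk hL) (L ^ mv) L (coverMargin L mv) k) (L ^ (mv + 1)))))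
        (-(mulOp (chiCube (cvM d L mv kk hL) (L ^ kk) (coverCorner (cvM d L mv kk hL) (L ^ mv) L (coverMargin L mv) k) (L ^ (mv + 1))) ∘ₗ
            symOp (cvM d L mv kk hL) (L ^ kk) (coverCorner (cvM d L mv kk hL) (L ^ mv) L (coverMargin L mv) k) ∘ₗ
          (gOp (cvM d L mv kk hL) (L ^ kk) a ∘ₗ symbOp (cvM d L mv kk hL) (L ^ kk) (((L ^ kk : ℕ) : ℝ) • (sTinv (cvM d L mv kk hL) (L ^ kk) μ - 1))) ∘ₗ
          mulOp (chiCube (cvM d L mv kk hL) (L ^ kk) (coverCorner (cvM d L mv kk hL) (L ^ mv) L (coverMargin L mv) k) (L ^ (mv + 1))))))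
      (fun y y' => ind ((cubeBlocks (cvM d L mv kk hL) (coverCorner (cvM d L mv kk hL) (L ^ mv) L (coverMargin L mv) k) (L ^ (mv + 1)) : Finset _) : Set _) y *
        ind ((cubeBlocks (cvM d L mv kk hL) (coverCorner (cvM d L mv kk hL) (L ^ mv) L (coverMargin L mv) k) (L ^ (mv + 1)) : Finset _) : Set _) y' *
        (m * ((L ^ kk : ℕ) : ℝ) ^ (-(1 / (8 * ((d : ℝ) + 1)))) * Real.exp (-(δb * tdistT (cvM d L mv kk hL) y y'))))) :
    HasMaj (BlockNorm.ofBlocks (unitTorusGeo L kk (cvM d L mv kk hL)) (fun b : CvX d L mv kk hL => blockOf (L ^ kk) (cvM d L mv kk hL) b.1))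
      (BlockNorm.ofBlocks (unitTorusGeo L kk (cvM d L mv kk hL)) (fun i : (Tor (fine (L ^ r * L ^ kk) (cvM d L mv kk hL)) × Fin (d + 1)) => blockOf (L ^ r * L ^ kk) (cvM d L mv kk hL) i.1))
      (idef (pull (kingPrV L kk r (cvM d L mv kk hL))) (pull (kingPrV L kk r (cvM d L mv kk hL)))
        (-(mulOp (chiCube (cvM d L mv kk hL) (L ^ r * L ^ kk) (coverCorner (cvM d L mv kk hL) (L ^ mv) L (coverMargin L mv) k) (L * L ^ mv)) ∘ₗ
            symOp (cvM d L mv kk hL) (L ^ r * L ^ kk) (coverCorner (cvM d L mv kk hL) (L ^ mv) L (coverMargin L mv) k) ∘ₗ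
          (gOp (cvM d L mv kk hL) (L ^ r * L ^ kk) a ∘ₗ symbOp (cvM d L mv kk hL) (L ^ r * L ^ kk) (((L ^ r * L ^ kk : ℕ) : ℝ) • (sTinv (cvM d L mv kk hL) (L ^ r * L ^ kk) μ - 1))) ∘ₗ
          mulOp (chiCube (cvM d L mv kk hL) (L ^ r * L ^ kk) (coverCorner (cvM d L mv kk hL) (L ^ mv) L (coverMargin L mv) k) (L * L ^ mv))))
        (-(mulOp (chiCube (cvM d L mv kk hL) (L ^ kk) (coverCorner (cvM d L mv kk hL) (L ^ mv) L (coverMargin L mv) k) (L * L ^ mv)) ∘ₗ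
            symOp (cvM d L mv kk hL) (L ^ kk) (coverCorner (cvM d L mv kk hL) (L ^ mv) L (coverMargin L mv) k) ∘ₗ
          (gOp (cvM d L mv kk hL) (L ^ kk) a ∘ₗ symbOp (cvM d L mv kk hL) (L ^ kk) (((L ^ kk : ℕ) : ℝ) • (sTinv (cvM d L mv kk hL) (L ^ kk) μ - 1))) ∘ₗ
          mulOp (chiCube (cvM d L mv kk hL) (L ^ kk) (coverCorner (cvM d L mv kk hL) (L ^ mv) L (coverMargin L mv) k) (L * L ^ mv)))))
      (fun y y' => ind (g := unitTorusGeo L kk (cvM d L mv kk hL)) (cvSk d L mv kk hL k) y * ind (g := unitTorusGeo L kk (cvM d L mv kk hL)) (cvSk d L mv kk hL k) y' *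
        (m * ((L ^ kk : ℕ) : ℝ) ^ (-(1 / (8 * ((d : ℝ) + 1)))) * Real.exp (-(δ * tdistT (cvM d L mv kk hL) y y')))) := by
  rw [show L ^ (mv + 1) = L * L ^ mv by rw [pow_succ, mul_comm]] at h
  exact hasMaj_rate_le (fun y y' => mul_nonneg (ind_nonneg _ _) (ind_nonneg _ _)) (mul_nonneg hm (Real.rpow_nonneg (Nat.cast_nonneg _) _)) hδ h

end Cover

/-! ## §2 The box-cut η-defect of a two-sidedly localized pair -/

section Cut

variable {X X' ι : Type} [Fintype X] [Fintype X'] [Fintype ι] {g : B6.Geometry} (blk : X → g.Site) (π : X' → X)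

/-- ★ `T ≤ 1_S1_S·k`, `𝔇(T′,T) ≤ 1_S1_S·m`, `|a′| ≤ 1`, `|a′ − a∘π| ≤ o` ⟹ `𝔇(M_{a′}T′, M_aT) ≤ 1_S1_S·(1·m + o·k)` (same rate) — `idef_comp` with dag-n15-w3 file 35's two cut rows.
[cite: Balaban1985BackgroundPropagators, Thm 3.14 pp.426–427 (difference template)] -/
theorem hasMaj_idef_cut_comp_loc₂ {T : (X × ι → ℝ) →ₗ[ℝ] (X × ι → ℝ)} {T' : (X' × ι → ℝ) →ₗ[ℝ] (X' × ι → ℝ)} {a : X → ℝ} {a' : X' → ℝ} {S : Set g.Site} {o k m δ : ℝ}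
    (ho : 0 ≤ o) (ha' : ∀ x', |a' x'| ≤ 1) (hfit : ∀ x', |a' x' - a (π x')| ≤ o)
    (hT : HasMaj (BlockNorm.ofBlocks g (liftBlk blk ι)) (BlockNorm.ofBlocks g (liftBlk blk ι)) T (fun y y' => ind S y * ind S y' * (k * Real.exp (-(δ * g.dist y y')))))
    (hD : HasMaj (BlockNorm.ofBlocks g (liftBlk blk ι)) (BlockNorm.ofBlocks g (liftBlk (blk ∘ π) ι)) (idef (pull (liftMap π ι)) (pull (liftMap π ι)) T' T)
      (fun y y' => ind S y * ind S y' * (m * Real.exp (-(δ * g.dist y y'))))) :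
    HasMaj (BlockNorm.ofBlocks g (liftBlk blk ι)) (BlockNorm.ofBlocks g (liftBlk (blk ∘ π) ι))
      (idef (pull (liftMap π ι)) (pull (liftMap π ι)) (mulOp (fun p : X' × ι => a' p.1) ∘ₗ T') (mulOp (fun p : X × ι => a p.1) ∘ₗ T))
      (fun y y' => ind S y * ind S y' * ((1 * m + o * k) * Real.exp (-(δ * g.dist y y')))) := by
  rw [idef_comp (pull (liftMap π ι)) (pull (liftMap π ι)) (pull (liftMap π ι)) (mulOp (fun p : X' × ι => a' p.1)) T' (mulOp (fun p : X × ι => a p.1)) T]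
  have t1 := hasMaj_mulOp_comp_loc₂' (liftBlk blk ι) (liftMap π ι) zero_le_one (fun p' : X' × ι => ha' p'.1) hD
  have t2 := hasMaj_idef_mulOp_comp_loc₂ (liftBlk blk ι) (liftMap π ι) (a' := fun p : X' × ι => a' p.1) (a := fun p : X × ι => a p.1) ho (fun p' : X' × ι => hfit p'.1) hT
  refine (t1.add t2).mono fun y y' => le_of_eq ?_
  ring

end Cut

end Summit.QuantumFields.YangMills.BalabanUVNodes.N15.Gluing

end
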